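import Summits.CriticalPhenomena.PercolationContinuityZ3.Theorems.PercNearOneGluingNoHeavyLowerTailAntitheticDegTwoClusters
import HarnessLib

/-!
# `NoHeavyLowerTail` (stmt-CriticalPhenomena-4575) — antithetic cluster pairs: DEG-2 ELIMINATION IN VERTEX FORM, part 2: the ONE-SIDED
# REDUCTION (THEOREM OS⊕-B of HOME/THEOREM-OneSided.md, prim-hp-2 gen 56)

Support file (`--supports stmt-CriticalPhenomena-4575`, hull-port prover `prim-hp-2`, gen 56).  No definitions, no named facts, no sorries;
standard axioms.  VERTEX version.  Setting and lemmas: …AntitheticDegTwoClusters (`x ≠ s` meets exactly the pairs `e = xy`, `f = xz` of `E`,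
`y ≠ z`, `g = yz ∉ E`; `E' = E ∖ {e, f}`; `X_A(ω) = openCluster (ω ∩ A) s`, `Y_A(ω) = openCluster (ωᶜ ∩ A) s`).

**`Antithetic.DegTwo.deg2_vertex_reduction`** (THEOREM OS⊕-B).  With
  `TI  = Σ_{ω : y ∉ X_{E'}(ω)} (F(X_{E'} ω) − F(Y_{E'} ω ∪ {x}·[z ∈ Y_{E'} ω]))(G(…) − G(…))` and
  `TII = Σ_{ω : y ∈ X_{E'}(ω), z ∉ Y_{E'}(ω)} (F(X_{E'} ω ∪ {x}) − F(Y_{E'} ω))(G(…) − G(…))` (sums over all `ω ⊆ Sym2 V`):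
`Σ_{D({x})} Δ = [tied part] + ½·TI + ½·TII`, the tied part is `≥ 0` (`DegTwo.tied_sum_nonneg`), hence
**`0 ≤ TI → 0 ≤ TII → 0 ≤ Σ_{D({x})} (F(X_E ω) − F(Y_E ω))(G(X_E ω) − G(Y_E ω))`**.  `TI ≥ 0` holds on every graph
(`Antithetic.termOne_nonneg` of …AntitheticTermOne, `A = {x}`), so CONJECTURE Δ2 / the vertex antithetic conjecture at a degree-2 vertex `x`
is reduced to the single ONE-SIDED inequality `TII ≥ 0` — certified (exact LP, pair-level dominated cubes of dimension ≤ 2) for FAT8 and all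
51 known SHT-less instances (HOME/MEMO-gen56.md §2), and implied across a cut vertex by ⊕-positivity of one side
(`Antithetic.oplus_composition_sum_nonneg`, THEOREM OS⊕-C).
[cite: VandenbergHaggstromKahn2005, §1 p. 6 ("Harris' inequality"), §1 p. 3 (open cluster `C_s`)]
-/

noncomputable section

namespace Summit.CriticalPhenomena.PercolationContinuityZ3.Theorems

open Literature.Probability.Percolation
open scoped Classical symmDiff

namespace Antithetic

namespace DegTwo

variable {V : Type*}

section Reduction

variable [Fintype V] {E : Set (Sym2 V)} {s x y z : V} (hxs : x ≠ s) (hxy : x ≠ y) (hxz : x ≠ z) (hyz : y ≠ z)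
  (he : s(x, y) ∈ E) (hf : s(x, z) ∈ E) (hdeg : ∀ h ∈ E, x ∈ h → h = s(x, y) ∨ h = s(x, z)) (hg : s(y, z) ∉ E)
include hxs hxy hxz hyz he hf hdeg hg

/-- **THEOREM OS⊕-B (deg-2 elimination in vertex form, the one-sided reduction).**  With `E' = E ∖ {xy, xz}` and
`X' ω = openCluster (ω ∩ E') s`, `Y' ω = openCluster (ωᶜ ∩ E') s`: if
`TI  = Σ_{ω : y ∉ X' ω} (F(X' ω) − F(Y' ω ∪ {x}·[z ∈ Y' ω]))(G(…) − G(…)) ≥ 0` (true on every graph: `Antithetic.termOne_nonneg`) and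
`TII = Σ_{ω : y ∈ X' ω, z ∉ Y' ω} (F(X' ω ∪ {x}) − F(Y' ω))(G(…) − G(…)) ≥ 0`, then the vertex antithetic sum over `D({x})` is
nonnegative: `0 ≤ Σ_{ω : ¬(x ∈ X_E ω ∧ x ∈ Y_E ω)} (F(X_E ω) − F(Y_E ω))(G(X_E ω) − G(Y_E ω))`.
Proof: `Σ_D = [tied part] + 2·[untied part with xy red]`, the untied part is `¼(TI + TII)` by the untied cluster formulas and coordinate
halving, the tied part is `tied_sum_nonneg`. [this work] -/
theorem deg2_vertex_reduction {F G : Set V → ℝ} (hF : Monotone F) (hG : Monotone G)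
    (hTI : 0 ≤ ∑ ω ∈ Finset.univ.filter (fun ω : Set (Sym2 V) =>
        ¬ (openGraph (ω ∩ (E \ {s(x, y), s(x, z)}))).Reachable s y),
      (F (openCluster (ω ∩ (E \ {s(x, y), s(x, z)})) s) -
          F (openCluster (ωᶜ ∩ (E \ {s(x, y), s(x, z)})) s ∪
            {v | v ∈ ({x} : Set V) ∧ z ∈ openCluster (ωᶜ ∩ (E \ {s(x, y), s(x, z)})) s})) *
        (G (openCluster (ω ∩ (E \ {s(x, y), s(x, z)})) s) -
          G (openCluster (ωᶜ ∩ (E \ {s(x, y), s(x, z)})) s ∪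
            {v | v ∈ ({x} : Set V) ∧ z ∈ openCluster (ωᶜ ∩ (E \ {s(x, y), s(x, z)})) s})))
    (hTII : 0 ≤ ∑ ω ∈ Finset.univ.filter (fun ω : Set (Sym2 V) =>
        (openGraph (ω ∩ (E \ {s(x, y), s(x, z)}))).Reachable s y ∧ ¬ (openGraph (ωᶜ ∩ (E \ {s(x, y), s(x, z)}))).Reachable s z),
      (F (openCluster (ω ∩ (E \ {s(x, y), s(x, z)})) s ∪ {x}) - F (openCluster (ωᶜ ∩ (E \ {s(x, y), s(x, z)})) s)) *
        (G (openCluster (ω ∩ (E \ {s(x, y), s(x, z)})) s ∪ {x}) - G (openCluster (ωᶜ ∩ (E \ {s(x, y), s(x, z)})) s))) :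
    0 ≤ ∑ ω ∈ Finset.univ.filter (fun ω : Set (Sym2 V) =>
        ¬ ((openGraph (ω ∩ E)).Reachable s x ∧ (openGraph (ωᶜ ∩ E)).Reachable s x)),
      (F (openCluster (ω ∩ E) s) - F (openCluster (ωᶜ ∩ E) s)) * (G (openCluster (ω ∩ E) s) - G (openCluster (ωᶜ ∩ E) s)) := by
  have hef := Contract.e_ne_f (x := x) hyz
  set E' := E \ {s(x, y), s(x, z)} with hE'
  have heE' : s(x, y) ∉ E' := fun h => h.2 (Or.inl rfl)
  have hfE' : s(x, z) ∉ E' := fun h => h.2 (Or.inr rfl)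
  let X' : Set (Sym2 V) → Set V := fun ω => openCluster (ω ∩ E') s
  let Y' : Set (Sym2 V) → Set V := fun ω => openCluster (ωᶜ ∩ E') s
  let Ψ : Set (Sym2 V) → ℝ := fun ω =>
    (F (openCluster (ω ∩ E) s) - F (openCluster (ωᶜ ∩ E) s)) * (G (openCluster (ω ∩ E) s) - G (openCluster (ωᶜ ∩ E) s))
  let ΨI : Set (Sym2 V) → ℝ := fun ω =>
    (F (X' ω) - F (Y' ω ∪ {v | v ∈ ({x} : Set V) ∧ z ∈ Y' ω})) * (G (X' ω) - G (Y' ω ∪ {v | v ∈ ({x} : Set V) ∧ z ∈ Y' ω}))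
  let ΨII : Set (Sym2 V) → ℝ := fun ω => (F (X' ω ∪ {x}) - F (Y' ω)) * (G (X' ω ∪ {x}) - G (Y' ω))
  let ΨU : Set (Sym2 V) → ℝ := fun ω =>
    (F (X' ω ∪ {v | v ∈ ({x} : Set V) ∧ y ∈ X' ω}) - F (Y' ω ∪ {v | v ∈ ({x} : Set V) ∧ z ∈ Y' ω})) *
      (G (X' ω ∪ {v | v ∈ ({x} : Set V) ∧ y ∈ X' ω}) - G (Y' ω ∪ {v | v ∈ ({x} : Set V) ∧ z ∈ Y' ω}))
  let Dp : Set (Sym2 V) → Prop := fun ω => ¬ ((openGraph (ω ∩ E)).Reachable s x ∧ (openGraph (ωᶜ ∩ E)).Reachable s x)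
  change 0 ≤ ∑ ω ∈ Finset.univ.filter (fun ω => ¬ (openGraph (ω ∩ E')).Reachable s y), ΨI ω at hTI
  change 0 ≤ ∑ ω ∈ Finset.univ.filter (fun ω => (openGraph (ω ∩ E')).Reachable s y ∧ ¬ (openGraph (ωᶜ ∩ E')).Reachable s z), ΨII ω
    at hTII
  show 0 ≤ ∑ ω ∈ Finset.univ.filter Dp, Ψ ω
  -- invariance of the `E'`-quantities under toggling `e` or `f`
  have hX'e : ∀ ω, X' (ω ∆ {s(x, y)}) = X' ω := fun ω => by
    show openCluster ((ω ∆ {s(x, y)}) ∩ E') s = openCluster (ω ∩ E') s; rw [symmDiff_singleton_inter heE']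
  have hY'e : ∀ ω, Y' (ω ∆ {s(x, y)}) = Y' ω := fun ω => by
    show openCluster ((ω ∆ {s(x, y)})ᶜ ∩ E') s = openCluster (ωᶜ ∩ E') s; rw [compl_symmDiff_singleton_inter heE']
  have hX'f : ∀ ω, X' (ω ∆ {s(x, z)}) = X' ω := fun ω => by
    show openCluster ((ω ∆ {s(x, z)}) ∩ E') s = openCluster (ω ∩ E') s; rw [symmDiff_singleton_inter hfE']
  have hY'f : ∀ ω, Y' (ω ∆ {s(x, z)}) = Y' ω := fun ω => by
    show openCluster ((ω ∆ {s(x, z)})ᶜ ∩ E') s = openCluster (ωᶜ ∩ E') s; rw [compl_symmDiff_singleton_inter hfE']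
  have hmem_e_f : ∀ ω : Set (Sym2 V), s(x, y) ∈ ω ∆ {s(x, z)} ↔ s(x, y) ∈ ω := fun ω => by
    rw [Set.mem_symmDiff, Set.mem_singleton_iff]
    constructor
    · rintro (⟨h, _⟩ | ⟨h, _⟩); exacts [h, absurd h hef]
    · exact fun h => Or.inl ⟨h, hef⟩
  -- (1) split `D` into tied / `e` red, `f` blue / `e` blue, `f` red
  have hsplit : ∑ ω ∈ Finset.univ.filter Dp, Ψ ω =
      ∑ ω ∈ (Finset.univ.filter Dp).filter (fun ω => (s(x, y) ∈ ω ↔ s(x, z) ∈ ω)), Ψ ω +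
      (∑ ω ∈ ((Finset.univ.filter Dp).filter (fun ω => ¬ (s(x, y) ∈ ω ↔ s(x, z) ∈ ω))).filter (fun ω => s(x, y) ∈ ω), Ψ ω +
       ∑ ω ∈ ((Finset.univ.filter Dp).filter (fun ω => ¬ (s(x, y) ∈ ω ↔ s(x, z) ∈ ω))).filter (fun ω => s(x, y) ∉ ω), Ψ ω) := by
    rw [Finset.sum_filter_add_sum_filter_not, Finset.sum_filter_add_sum_filter_not]
  -- (2) the tied part: every tied colouring lies in `D`
  have htied : ∑ ω ∈ (Finset.univ.filter Dp).filter (fun ω => (s(x, y) ∈ ω ↔ s(x, z) ∈ ω)), Ψ ω =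
      ∑ ω ∈ Finset.univ.filter (fun ω : Set (Sym2 V) => (s(x, y) ∈ ω ↔ s(x, z) ∈ ω)), Ψ ω := by
    refine Finset.sum_congr ?_ fun _ _ => rfl
    ext ω
    simp only [Finset.mem_filter, Finset.mem_univ, true_and]
    exact ⟨fun h => h.2, fun h => ⟨not_both_of_tied hxs hdeg ω h, h⟩⟩
  have htied0 := tied_sum_nonneg hxs hxy hxz hyz he hf hdeg hg hF hG
  -- (3) the `e`-blue / `f`-red part equals the `e`-red / `f`-blue part (complement the colouring)
  have hΨc : ∀ ω, Ψ ωᶜ = Ψ ω := fun ω => by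
    show (F (openCluster (ωᶜ ∩ E) s) - F (openCluster (ωᶜᶜ ∩ E) s)) * (G (openCluster (ωᶜ ∩ E) s) - G (openCluster (ωᶜᶜ ∩ E) s)) =
      (F (openCluster (ω ∩ E) s) - F (openCluster (ωᶜ ∩ E) s)) * (G (openCluster (ω ∩ E) s) - G (openCluster (ωᶜ ∩ E) s))
    rw [compl_compl]; ring
  have hDc : ∀ ω, Dp ωᶜ ↔ Dp ω := fun ω => by
    show ¬ ((openGraph (ωᶜ ∩ E)).Reachable s x ∧ (openGraph (ωᶜᶜ ∩ E)).Reachable s x) ↔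
      ¬ ((openGraph (ω ∩ E)).Reachable s x ∧ (openGraph (ωᶜ ∩ E)).Reachable s x)
    rw [compl_compl, and_comm]
  have hmirror :
      ∑ ω ∈ ((Finset.univ.filter Dp).filter (fun ω => ¬ (s(x, y) ∈ ω ↔ s(x, z) ∈ ω))).filter (fun ω => s(x, y) ∉ ω), Ψ ω =
      ∑ ω ∈ ((Finset.univ.filter Dp).filter (fun ω => ¬ (s(x, y) ∈ ω ↔ s(x, z) ∈ ω))).filter (fun ω => s(x, y) ∈ ω), Ψ ω := by
    refine Finset.sum_nbij' compl compl ?_ ?_ ?_ ?_ ?_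
    · intro ω hω
      simp only [Finset.mem_filter, Finset.mem_univ, true_and] at hω ⊢
      obtain ⟨⟨hD, hnt⟩, hne⟩ := hω
      refine ⟨⟨(hDc ω).2 hD, ?_⟩, ?_⟩
      · rw [Set.mem_compl_iff, Set.mem_compl_iff]; tauto
      · exact hne
    · intro ω hω
      simp only [Finset.mem_filter, Finset.mem_univ, true_and] at hω ⊢
      obtain ⟨⟨hD, hnt⟩, hme⟩ := hω
      refine ⟨⟨(hDc ω).2 hD, ?_⟩, ?_⟩
      · rw [Set.mem_compl_iff, Set.mem_compl_iff]; tauto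
      · rw [Set.mem_compl_iff, not_not]; exact hme
    · intro ω _; exact compl_compl ω
    · intro ω _; exact compl_compl ω
    · intro ω _; exact (hΨc ω).symm
  -- (4) the untied part with `e` red, `f` blue, rewritten on `E'`
  have huntied :
      ∑ ω ∈ ((Finset.univ.filter Dp).filter (fun ω => ¬ (s(x, y) ∈ ω ↔ s(x, z) ∈ ω))).filter (fun ω => s(x, y) ∈ ω), Ψ ω =
      ∑ ω ∈ Finset.univ.filter (fun ω : Set (Sym2 V) =>
        (s(x, y) ∈ ω ∧ s(x, z) ∉ ω) ∧ ¬ (y ∈ X' ω ∧ z ∈ Y' ω)), ΨU ω := by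
    refine Finset.sum_congr ?_ ?_
    · ext ω
      simp only [Finset.mem_filter, Finset.mem_univ, true_and]
      constructor
      · rintro ⟨⟨hD, hnt⟩, h1⟩
        have h2 : s(x, z) ∉ ω := fun h2 => hnt ⟨fun _ => h2, fun _ => h1⟩
        refine ⟨⟨h1, h2⟩, fun ⟨hy, hz⟩ => hD ⟨?_, ?_⟩⟩
        · show x ∈ openCluster (ω ∩ E) s
          rw [red_untied hxs hxy he hdeg ω h1 h2]; exact Or.inr ⟨rfl, hy⟩
        · show x ∈ openCluster (ωᶜ ∩ E) s
          rw [blue_untied hxs hxz hf hdeg ω h1 h2]; exact Or.inr ⟨rfl, hz⟩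
      · rintro ⟨⟨h1, h2⟩, hn⟩
        refine ⟨⟨fun ⟨hr, hb⟩ => hn ⟨?_, ?_⟩, fun h => h2 (h.1 h1)⟩, h1⟩
        · have hr' : x ∈ openCluster (ω ∩ E) s := hr
          rw [red_untied hxs hxy he hdeg ω h1 h2] at hr'
          rcases hr' with h | ⟨-, h⟩
          · exact absurd (show (openGraph (ω ∩ E')).Reachable s x from h)
              (Pendant.not_reachable_leaf (ω ∩ E') x (fun h hh hx => x_isolated hdeg h hh.2 hx) hxs.symm)
          · exact h
        · have hb' : x ∈ openCluster (ωᶜ ∩ E) s := hb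
          rw [blue_untied hxs hxz hf hdeg ω h1 h2] at hb'
          rcases hb' with h | ⟨-, h⟩
          · exact absurd (show (openGraph (ωᶜ ∩ E')).Reachable s x from h)
              (Pendant.not_reachable_leaf (ωᶜ ∩ E') x (fun h hh hx => x_isolated hdeg h hh.2 hx) hxs.symm)
          · exact h
    · intro ω hω
      simp only [Finset.mem_filter, Finset.mem_univ, true_and] at hω
      obtain ⟨⟨h1, h2⟩, -⟩ := hω
      show (F (openCluster (ω ∩ E) s) - F (openCluster (ωᶜ ∩ E) s)) * (G (openCluster (ω ∩ E) s) - G (openCluster (ωᶜ ∩ E) s)) = ΨU ω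
      rw [red_untied hxs hxy he hdeg ω h1 h2, blue_untied hxs hxz hf hdeg ω h1 h2]
  -- (5) split the untied part by `y ∈ X'` (nested filters, to match the coordinate-halving lemmas)
  let SI : Finset (Set (Sym2 V)) := ((Finset.univ.filter (fun ω : Set (Sym2 V) =>
      ¬ (openGraph (ω ∩ E')).Reachable s y)).filter (fun ω => s(x, y) ∈ ω)).filter (fun ω => s(x, z) ∉ ω)
  let SII : Finset (Set (Sym2 V)) := ((Finset.univ.filter (fun ω : Set (Sym2 V) =>
      (openGraph (ω ∩ E')).Reachable s y ∧ ¬ (openGraph (ωᶜ ∩ E')).Reachable s z)).filter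
        (fun ω => s(x, y) ∈ ω)).filter (fun ω => s(x, z) ∉ ω)
  have husplit : ∑ ω ∈ Finset.univ.filter (fun ω : Set (Sym2 V) =>
        (s(x, y) ∈ ω ∧ s(x, z) ∉ ω) ∧ ¬ (y ∈ X' ω ∧ z ∈ Y' ω)), ΨU ω = ∑ ω ∈ SI, ΨI ω + ∑ ω ∈ SII, ΨII ω := by
    rw [← Finset.sum_filter_add_sum_filter_not _ (fun ω => y ∈ X' ω), add_comm]
    congr 1
    · refine Finset.sum_congr ?_ ?_
      · ext ω
        simp only [SI, Finset.mem_filter, Finset.mem_univ, true_and]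
        show ((s(x, y) ∈ ω ∧ s(x, z) ∉ ω) ∧ ¬ (y ∈ X' ω ∧ z ∈ Y' ω)) ∧ y ∉ X' ω ↔ (y ∉ X' ω ∧ s(x, y) ∈ ω) ∧ s(x, z) ∉ ω
        tauto
      · intro ω hω
        simp only [SI, Finset.mem_filter, Finset.mem_univ, true_and] at hω
        have hy : y ∉ X' ω := hω.1.1
        have hset : X' ω ∪ {v | v ∈ ({x} : Set V) ∧ y ∈ X' ω} = X' ω := by
          ext v; simp only [Set.mem_union, Set.mem_setOf_eq]; tauto
        show (F (X' ω ∪ {v | v ∈ ({x} : Set V) ∧ y ∈ X' ω}) - F (Y' ω ∪ {v | v ∈ ({x} : Set V) ∧ z ∈ Y' ω})) *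
          (G (X' ω ∪ {v | v ∈ ({x} : Set V) ∧ y ∈ X' ω}) - G (Y' ω ∪ {v | v ∈ ({x} : Set V) ∧ z ∈ Y' ω})) = ΨI ω
        rw [hset]
    · refine Finset.sum_congr ?_ ?_
      · ext ω
        simp only [SII, Finset.mem_filter, Finset.mem_univ, true_and]
        show ((s(x, y) ∈ ω ∧ s(x, z) ∉ ω) ∧ ¬ (y ∈ X' ω ∧ z ∈ Y' ω)) ∧ y ∈ X' ω ↔
          ((y ∈ X' ω ∧ z ∉ Y' ω) ∧ s(x, y) ∈ ω) ∧ s(x, z) ∉ ω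
        tauto
      · intro ω hω
        simp only [SII, Finset.mem_filter, Finset.mem_univ, true_and] at hω
        have hy : y ∈ X' ω := hω.1.1.1
        have hz : z ∉ Y' ω := hω.1.1.2
        have hset1 : X' ω ∪ {v | v ∈ ({x} : Set V) ∧ y ∈ X' ω} = X' ω ∪ {x} := by
          ext v; simp only [Set.mem_union, Set.mem_setOf_eq, Set.mem_singleton_iff]; tauto
        have hset2 : Y' ω ∪ {v | v ∈ ({x} : Set V) ∧ z ∈ Y' ω} = Y' ω := by
          ext v; simp only [Set.mem_union, Set.mem_setOf_eq]; tauto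
        show (F (X' ω ∪ {v | v ∈ ({x} : Set V) ∧ y ∈ X' ω}) - F (Y' ω ∪ {v | v ∈ ({x} : Set V) ∧ z ∈ Y' ω})) *
          (G (X' ω ∪ {v | v ∈ ({x} : Set V) ∧ y ∈ X' ω}) - G (Y' ω ∪ {v | v ∈ ({x} : Set V) ∧ z ∈ Y' ω})) = ΨII ω
        rw [hset1, hset2]
  -- (6) coordinate halving: the full `E'`-sums are four times the restricted ones
  have hPe : ∀ ω, ω ∆ {s(x, y)} ∈ Finset.univ.filter (fun ω : Set (Sym2 V) => ¬ (openGraph (ω ∩ E')).Reachable s y) ↔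
      ω ∈ Finset.univ.filter (fun ω : Set (Sym2 V) => ¬ (openGraph (ω ∩ E')).Reachable s y) := fun ω => by
    simp only [Finset.mem_filter, Finset.mem_univ, true_and]; rw [symmDiff_singleton_inter heE']
  have hPf : ∀ ω, ω ∆ {s(x, z)} ∈ (Finset.univ.filter (fun ω : Set (Sym2 V) =>
      ¬ (openGraph (ω ∩ E')).Reachable s y)).filter (fun ω => s(x, y) ∈ ω) ↔
      ω ∈ (Finset.univ.filter (fun ω : Set (Sym2 V) => ¬ (openGraph (ω ∩ E')).Reachable s y)).filter (fun ω => s(x, y) ∈ ω) :=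
    fun ω => by simp only [Finset.mem_filter, Finset.mem_univ, true_and]; rw [symmDiff_singleton_inter hfE', hmem_e_f]
  have hI1 := sum_toggle s(x, y) _ ΨI hPe (fun ω => by show ΨI (ω ∆ {s(x, y)}) = ΨI ω; simp only [ΨI, hX'e, hY'e])
  have hI2 := sum_toggle_not s(x, z) _ ΨI hPf (fun ω => by show ΨI (ω ∆ {s(x, z)}) = ΨI ω; simp only [ΨI, hX'f, hY'f])
  have hTI' : (0 : ℝ) ≤ 2 * (2 * ∑ ω ∈ SI, ΨI ω) := by
    have h := hTI
    rw [hI1, hI2] at h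
    exact h
  have hQe : ∀ ω, ω ∆ {s(x, y)} ∈ Finset.univ.filter (fun ω : Set (Sym2 V) =>
      (openGraph (ω ∩ E')).Reachable s y ∧ ¬ (openGraph (ωᶜ ∩ E')).Reachable s z) ↔
      ω ∈ Finset.univ.filter (fun ω : Set (Sym2 V) =>
        (openGraph (ω ∩ E')).Reachable s y ∧ ¬ (openGraph (ωᶜ ∩ E')).Reachable s z) := fun ω => by
    simp only [Finset.mem_filter, Finset.mem_univ, true_and]
    rw [symmDiff_singleton_inter heE', compl_symmDiff_singleton_inter heE']
  have hQf : ∀ ω, ω ∆ {s(x, z)} ∈ (Finset.univ.filter (fun ω : Set (Sym2 V) =>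
      (openGraph (ω ∩ E')).Reachable s y ∧ ¬ (openGraph (ωᶜ ∩ E')).Reachable s z)).filter (fun ω => s(x, y) ∈ ω) ↔
      ω ∈ (Finset.univ.filter (fun ω : Set (Sym2 V) =>
        (openGraph (ω ∩ E')).Reachable s y ∧ ¬ (openGraph (ωᶜ ∩ E')).Reachable s z)).filter (fun ω => s(x, y) ∈ ω) :=
    fun ω => by
      simp only [Finset.mem_filter, Finset.mem_univ, true_and]
      rw [symmDiff_singleton_inter hfE', compl_symmDiff_singleton_inter hfE', hmem_e_f]
  have hII1 := sum_toggle s(x, y) _ ΨII hQe (fun ω => by show ΨII (ω ∆ {s(x, y)}) = ΨII ω; simp only [ΨII, hX'e, hY'e])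
  have hII2 := sum_toggle_not s(x, z) _ ΨII hQf (fun ω => by show ΨII (ω ∆ {s(x, z)}) = ΨII ω; simp only [ΨII, hX'f, hY'f])
  have hTII' : (0 : ℝ) ≤ 2 * (2 * ∑ ω ∈ SII, ΨII ω) := by
    have h := hTII
    rw [hII1, hII2] at h
    exact h
  -- (7) assemble
  rw [hsplit, htied, hmirror, huntied, husplit]
  linarith [htied0, hTI', hTII']

end Reduction

end DegTwo

end Antithetic

end Summit.CriticalPhenomena.PercolationContinuityZ3.Theorems
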